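import Summits.QuantumFields.BalabanUV.T4Continuum.Support.NE3FineCriticalGeneral
import Summits.QuantumFields.BalabanUV.T4Continuum.Support.AveragingDeficitMultiLevelFermat
import Summits.QuantumFields.BalabanUV.T4Continuum.Support.AveragingDeficitMultiLevelBridge
import HarnessLib

/-!
# T⁴ programme, node NE3 — row E-RES♯, sub-row R♯5 (assembly), file (5a): THE CURL-PAIRED RESIDUAL OF THE AVERAGED
# `(j+2)`-LEVEL CONSTRAINED MINIMISER ALONG THE PUSH-FORWARD OF ANY TANGENT FINE DIRECTION (the curl-paired twin of NE3-R2's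
# `AveragingDeficitMultiLevelFermat.dualResidual_multiLevel`)

NE3 formalisation swarm, LEAF PROVER 02 (unit `b2b-balaban-t4-ne3-formalise-leaf-02`, gen 4; cell `pub-balaban`); owner CUT «E-RES♯
INTO ROWS» (journal 2026-08-20T14:09Z), row (R♯5) «ASSEMBLY = (RES♯) BY NAME»; SHAPE `t4/formal/NE3/Statements/E-RES-R5-SHAPE-v1.md`.

WHAT.  NE3-R2's `dualResidual_multiLevel` bounds the derivative of the COARSE Wilson action of `V̄ = bavg L V` along a coarse
tangent direction `φ` by `wallConst·(√gradFluxSq·dualC2·‖φ‖_ℓ² + a²·dualC1·‖φ‖_ℓ¹)` — the ℓ²-PAIRED form, obtained from the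
FACE lift of `φ` (whose dressed curl is only `≤ √(8#Pl)·‖·‖_ℓ²`).  The surviving variant (R3) of NE3's local half needs the residual
paired with the CURL of the direction (socket `NE3EnergyWeightedShapes.CurlPairedResidual`).  NE3-R2's β-wall IS curl-paired at the
FINE level (`AveragingDeficitResidualPairing.residualPairing_torus`: `L^{d−4}|D_c| ≤ wallConst·(√gradFluxSq(V)·√curlSq_V ψ + a²·(dirL1 ψ +
curlL1_V ψ))` for ANY fine skew periodic `ψ` critical for the fine action); the owner's R♯2 (`NE3FineCriticalGeneral`) supplies
criticality of a constrained minimiser along EVERY tangent `ψ` (support hypothesis dropped).  THIS FILE runs NE3-R2's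
`(j+2)`-level constraint construction (`levelQ`, `hasStrictFDerivAt_levelQ`, `levelQ'_onto`, the `Near` side condition, the honest
minimality `hmin`) through R♯2 instead of the face-supported `fineCritical_of_isLocalMin`, and concludes with `residualPairing_torus`:

* **`hasDerivAt_fineAction_vary_multiLevel`** — the `(j+2)`-level constrained minimiser `V` (honest composite constraint
  `cavgIter L (j+2) U = cavgIter L (j+2) V` on the small-field class) is critical for the fine action of the period along EVERY skew
  periodic fine `ψ` whose push-forward `cpush L V ψ` is tangent to the fibre of the `(j+1)`-fold average at `cavg L V`
  (`TangentIter L j (cavg L V) (cpush L V ψ)`);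
* **`residualPairing_multiLevel`** — for such `ψ` and every derivative `D_c` at `0` of `s ↦ A^L(V̄ e^{s·pushDir ψ})` over the period:
  `L^{d−4}·|D_c| ≤ wallConst·(√gradFluxSq V·√(curlSq V ψ) + a²·(dirL1 ψ + curlL1 V ψ))` (all over `blockSites L (periodBox (L·tower j))`);
* `residualPairing_avgIter` — the same with Bałaban's `avgIter` in the constraint (`cavgIter_eq_avgIter`).
File (5b) feeds an EXACT lift `ψ` of a coarse tangent direction `φ` (R♯4 ∕ `SpreadLift.spreadInverse`) with curl controlled by R♯3b.

HONEST FRAMING.  A re-assembly of NE3-R2's and the owner's kernel theorems (no new analytic estimate); nothing printed is a hypothesis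
(context: [Balaban1985Variational] (26)–(27) p.282, (83) p.290, §E (115)–(121) p.295); (RES♯), T-E_w♯, NE3 NOT proved; spine PROVED
0∕9; finite T⁴ rung (B)+1 — NOT infinite volume, NOT mass gap, NOT `BetaPertH`, NOT Clay.  No `def`, no `sorry`.  PLACEMENT:
`Summits/QuantumFields/BalabanUV/`.  HONEST DEPENDENCY: continuum YM on T⁴ ⇐ BetaPertH ∧ nine spine estimates (0/9 proved); BetaPertH ⇐
(D1) ∧ (D4) ∧ CAP+tail; G-an2-4 gates asym, D1 and NE2/3/4.
-/

set_option autoImplicit false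

open scoped BigOperators Matrix Matrix.Norms.L2Operator Topology
open NormedSpace Finset Filter

namespace Summit.QuantumFields.BalabanUV.T4Continuum.NE3CurlPairedResidualMulti

open Literature.MathematicalPhysics.QuantumFieldTheory.Balaban1983to89
open B7Prop1Explicit B7Prop2Explicit MatrixLog UnitaryModel
open T4AveragingDeficitWall hiding Site Plane Plaq Bond
open T4AveragingDeficitWallBoundary (IsPeriodicCfg periodBox)
open AveragingDeficitTransport AveragingDeficitPlaqDeriv AveragingDeficitSideDeriv AveragingDeficitPeriodicCounting
open AveragingDeficitDerivWallProof AveragingDeficitResidualPairing AveragingDeficitFaceWords AveragingDeficitFaceLift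
open AveragingDeficitLiftPeriodic
open AveragingDeficitDualResidual AveragingDeficitTorusChart AveragingDeficitChartCalculus AveragingDeficitFermat
open AveragingDeficitTwoLevelPrep AveragingDeficitTwoLevelFermat AveragingDeficitMultiLevelPrep AveragingDeficitMultiLevelFermat
open AveragingDeficitMultiLevelBridge (cavgIter_eq_avgIter)
open NE3FineCriticalGeneral (hasDerivAt_fineAction_vary_of_isLocalMin)

noncomputable section

variable {d : ℕ} {n : Type*} [Fintype n] [DecidableEq n]

/-! ## §1 Criticality of the `(j+2)`-level constrained minimiser along every tangent fine direction -/

/-- **THE `(j+2)`-LEVEL CONSTRAINED MINIMISER IS CRITICAL ALONG EVERY TANGENT FINE DIRECTION.**  Let `V` be unitary of period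
`L·(L·tower L M′ j)`, `SmallField V a`, `0 ≤ a < b`, `LevelSmall d L (j+1) b`, and a minimiser of the fine Wilson action of the period
among the unitary `U` of the same period with `SmallField U b` and the same `(j+2)`-fold average `cavgIter L (j+2) U = cavgIter L (j+2) V`.
Then for EVERY skew fine direction `ψ` of period `L·(L·tower j)` whose push-forward is tangent to the fibre of the `(j+1)`-fold average
at `cavg L V` (`TangentIter L j (cavg L V) (cpush L V ψ)`): `HasDerivAt (s ↦ A_fine(V e^{sψ})) 0 0`.  NE3-R2's `fineCritical_multiLevel`
construction (levelQ, its strict derivative and onto differential, the `Near` side condition) fed to the owner's support-free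
`NE3FineCriticalGeneral.hasDerivAt_fineAction_vary_of_isLocalMin`; tangency transferred by `levelQ'_resDir_eq_zero`. [folklore] -/
theorem hasDerivAt_fineAction_vary_multiLevel [Nonempty n] {L M' : ℕ} [NeZero L] [NeZero M'] (j : ℕ)
    {V : Site d → Fin d → (Matrix n n ℂ)ˣ} (hV : IsUnitaryCfg V) (hVP : IsPeriodicCfg V ((L : ℤ) * (L * tower L M' j : ℕ)))
    {a b : ℝ} (ha : 0 ≤ a) (hab : a < b) (hb : LevelSmall d L (j + 1) b) (hVa : SmallField V a)
    (hmin : ∀ U : Site d → Fin d → (Matrix n n ℂ)ˣ, IsUnitaryCfg U → IsPeriodicCfg U ((L : ℤ) * (L * tower L M' j : ℕ)) →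
      SmallField U b → cavgIter L (j + 2) U = cavgIter L (j + 2) V →
        fineAction V (blockWindow L (periodBox (L * tower L M' j))).2
          ≤ fineAction U (blockWindow L (periodBox (L * tower L M' j))).2)
    {ψ : Site d → Fin d → Matrix n n ℂ} (hψs : IsSkewDir ψ) (hψP : IsPeriodicDir ψ ((L : ℤ) * (L * tower L M' j : ℕ)))
    (hψT : TangentIter L j (cavg L V) (cpush L V ψ)) :
    HasDerivAt (fun s : ℝ => fineAction (vary V ψ s) (blockWindow L (periodBox (L * tower L M' j))).2) 0 0 := by
  have hL : 1 ≤ L := Nat.one_le_iff_ne_zero.mpr (NeZero.ne L)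
  have hb0 : 0 ≤ b := ha.trans hab.le
  have haS : LevelSmall d L (j + 1) a := LevelSmall.mono ha hab.le hb
  set N : ℕ := L * tower L M' j with hN
  haveI : NeZero N := ⟨Nat.mul_ne_zero (NeZero.ne L) (tower_ne_zero L M' j)⟩
  obtain ⟨hliftA, ha1, -, -⟩ := smallness_of_twoLevelSmall (d := d) hL ha haS.1
  have h512a := small512_of_liftSmall hL ha hliftA
  -- the base `cavg L V` one level up
  have hV₁u : IsUnitaryCfg (cavg L V) := cavg_isUnitaryCfg hL hV ha h512a hVa
  have hV₁P : IsPeriodicCfg (cavg L V) ((L : ℤ) * (tower L M' j : ℕ)) := by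
    have h := isPeriodicCfg_cavg L N hVP
    have e : ((N : ℕ) : ℤ) = (L : ℤ) * (tower L M' j : ℕ) := by rw [hN]; push_cast; ring
    rw [e] at h
    exact h
  have hV₁a : SmallField (cavg L V) (prop1Radius d L a) := smallField_cavg hL hV ha h512a hVa
  haveI : CompleteSpace ↥(skewSub d n M') := FiniteDimensional.complete ℝ _
  have hQ := hasStrictFDerivAt_levelQ (M' := M') hL j hV₁u hV₁P ha1 haS.2 hV₁a
  have hQ' := levelQ'_onto (M' := M') hL j hV₁u hV₁P ha1 haS.2 hV₁a
  -- the top average of `V`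
  have hVPt : IsPeriodicCfg V ((tower L M' (j + 2) : ℕ) : ℤ) := by rw [natCast_tower_succ]; exact hVP
  obtain ⟨hXVu, -, -⟩ := cavgIter_unitary_small hL (j + 1) hV ha haS hVa
  have hXVP : IsPeriodicCfg (cavgIter L (j + 2) V) (M' : ℤ) := isPeriodicCfg_cavgIter L M' (j + 2) hVPt
  -- the side condition: small-field `b` and top averages relatively within `1/4`
  set Near : (Site d → Fin d → (Matrix n n ℂ)ˣ) → Prop := fun U => SmallField U b ∧ ∀ (r : Fin d → Fin M') (κ : Fin d),
    ‖(((cavgIter L (j + 2) V (boxVec M' r) κ)⁻¹ : (Matrix n n ℂ)ˣ) : Matrix n n ℂ)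
      * (cavgIter L (j + 2) U (boxVec M' r) κ : Matrix n n ℂ) - 1‖ ≤ 1 / 4 with hNear
  have hVP' : IsPeriodicCfg V ((L * N : ℕ) : ℤ) := by rw [natCast_mul_period]; exact hVP
  have hNearE : ∀ᶠ θ in 𝓝 (0 : TDir d n (L * N)), Near (chart skewP (L * N) V θ) := by
    refine (eventually_smallField_chart skewP (L * N) hVP' hab hVa).and ?_
    refine Filter.eventually_all.mpr fun r => Filter.eventually_all.mpr fun κ => ?_
    have hc0 := continuousAt_cavgIter_chart (d := d) (n := n) hL M' (j + 1) skewP hV hVP ha haS hVa (boxVec M' r) κ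
    have hc : ContinuousAt (fun θ : TDir d n (L * N) =>
        ‖(((cavgIter L (j + 2) V (boxVec M' r) κ)⁻¹ : (Matrix n n ℂ)ˣ) : Matrix n n ℂ)
          * ((cavgIter L (j + 2) (chart skewP (L * N) V θ) (boxVec M' r) κ : (Matrix n n ℂ)ˣ) : Matrix n n ℂ) - 1‖) 0 :=
      ((continuousAt_const.mul hc0).sub continuousAt_const).norm
    have h0 : ‖(((cavgIter L (j + 2) V (boxVec M' r) κ)⁻¹ : (Matrix n n ℂ)ˣ) : Matrix n n ℂ)
        * ((cavgIter L (j + 2) (chart skewP (L * N) V 0) (boxVec M' r) κ : (Matrix n n ℂ)ˣ) : Matrix n n ℂ) - 1‖ < 1 / 4 := by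
      rw [chart_zero, Units.inv_mul, sub_self, norm_zero]
      norm_num
    exact (hc.eventually (gt_mem_nhds h0)).mono fun θ hθ => hθ.le
  -- the honest minimality gives the chart-constrained minimality under `Near`
  have hmin' : ∀ U : Site d → Fin d → (Matrix n n ℂ)ˣ, IsUnitaryCfg U → IsPeriodicCfg U ((L : ℤ) * N) → Near U →
      levelQ L M' j (cavg L V) (cavg L U) = levelQ L M' j (cavg L V) (cavg L V) →
        fineAction V (blockWindow L (periodBox N)).2 ≤ fineAction U (blockWindow L (periodBox N)).2 := by
    intro U hU hUP hUN hUQ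
    obtain ⟨hUb, hUnear⟩ := hUN
    rw [levelQ_self] at hUQ
    have hUPt : IsPeriodicCfg U ((tower L M' (j + 2) : ℕ) : ℤ) := by rw [natCast_tower_succ]; exact hUP
    obtain ⟨hXUu, -, -⟩ := cavgIter_unitary_small hL (j + 1) hU hb0 hb hUb
    have hXUP : IsPeriodicCfg (cavgIter L (j + 2) U) (M' : ℤ) := isPeriodicCfg_cavgIter L M' (j + 2) hUPt
    have heq : cavgIter L (j + 2) U = cavgIter L (j + 2) V :=
      eq_of_skewPR_relLog_eq_zero hXVP hXUP hXVu hXUu hUnear hUQ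
    exact hmin U hU hUP hUb heq
  -- the tangency of the push-forward in the form `levelQ' … = 0`
  have hψP' : IsPeriodicDir (cpush L V ψ) ((L * tower L M' j : ℕ) : ℤ) := by
    have h := isPeriodicDir_cpush L N hVP hψP
    rw [hN] at h
    exact h
  have hTc : levelQ' L M' j (cavg L V) (resDir (L * tower L M' j) fun y κ => pushDir L V ψ ((L : ℤ) • y) κ) = 0 :=
    levelQ'_resDir_eq_zero hL j hV₁u hV₁P (prop1Radius_nonneg ha) haS.2 hV₁a hψP' hψT
  exact hasDerivAt_fineAction_vary_of_isLocalMin (M := N) hV hVP ha hliftA hVa (levelQ L M' j (cavg L V))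
    (levelQ' L M' j (cavg L V)) hQ hQ' Near hNearE hmin' hψs hψP hTc

/-! ## §2 The curl-paired residual along the push-forward of a tangent fine direction -/

/-- **THE CURL-PAIRED β-WALL FOR THE `(j+2)`-LEVEL CONSTRAINED MINIMISER** (curl-paired twin of NE3-R2's `dualResidual_multiLevel`).
Under the hypotheses of `hasDerivAt_fineAction_vary_multiLevel`, for every derivative `D_c` at `0` of the COARSE action of
`V̄ = bavg L V` over the period along the push-forward `pushDir L V ψ`:
`L^{d−4}·|D_c| ≤ wallConst·(√gradFluxSq V·√(curlSq V ψ) + a²·(dirL1 ψ + curlL1 V ψ))`, all norms over `blockSites L (periodBox (L·tower j))`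
(NE3-R2's `residualPairing_torus` fed by §1).  With `ψ` a curl-controlled EXACT lift of a coarse tangent direction (R♯3b + R♯4) this
is the socket (RES♯) — file (5b). [folklore] -/
theorem residualPairing_multiLevel [Nonempty n] {L M' : ℕ} [NeZero L] [NeZero M'] (j : ℕ)
    {V : Site d → Fin d → (Matrix n n ℂ)ˣ} (hV : IsUnitaryCfg V) (hVP : IsPeriodicCfg V ((L : ℤ) * (L * tower L M' j : ℕ)))
    {a b : ℝ} (ha : 0 ≤ a) (hab : a < b) (hb : LevelSmall d L (j + 1) b) (hVa : SmallField V a)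
    (hmin : ∀ U : Site d → Fin d → (Matrix n n ℂ)ˣ, IsUnitaryCfg U → IsPeriodicCfg U ((L : ℤ) * (L * tower L M' j : ℕ)) →
      SmallField U b → cavgIter L (j + 2) U = cavgIter L (j + 2) V →
        fineAction V (blockWindow L (periodBox (L * tower L M' j))).2
          ≤ fineAction U (blockWindow L (periodBox (L * tower L M' j))).2)
    {ψ : Site d → Fin d → Matrix n n ℂ} (hψs : IsSkewDir ψ) (hψP : IsPeriodicDir ψ ((L : ℤ) * (L * tower L M' j : ℕ)))
    (hψT : TangentIter L j (cavg L V) (cpush L V ψ)) {Dc : ℝ}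
    (hDc : HasDerivAt
      (fun s : ℝ => coarseActionOf L (vary (bavg L V) (pushDir L V ψ) s) (blockWindow L (periodBox (L * tower L M' j))).1) Dc 0) :
    (L : ℝ) ^ ((d : ℤ) - 4) * |Dc|
      ≤ wallConst d L * (Real.sqrt (gradFluxSq V (blockSites L (periodBox (L * tower L M' j))))
          * Real.sqrt (curlSq V ψ (blockSites L (periodBox (L * tower L M' j))))
        + a ^ 2 * (dirL1 ψ (blockSites L (periodBox (L * tower L M' j)))
          + curlL1 V ψ (blockSites L (periodBox (L * tower L M' j))))) := by
  have hL : 1 ≤ L := Nat.one_le_iff_ne_zero.mpr (NeZero.ne L)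
  have hLN : 1 ≤ L * tower L M' j := Nat.one_le_iff_ne_zero.mpr (Nat.mul_ne_zero (NeZero.ne L) (tower_ne_zero L M' j))
  have haS : LevelSmall d L (j + 1) a := LevelSmall.mono ha hab.le hb
  obtain ⟨hliftA, -, -, -⟩ := smallness_of_twoLevelSmall (d := d) hL ha haS.1
  have hcrit := hasDerivAt_fineAction_vary_multiLevel j hV hVP ha hab hb hVa hmin hψs hψP hψT
  have ha₀ : a ≤ 1 / (512 * (d + 1) * (d + 4) * (L : ℝ) ^ 2) := by
    have h512 : 512 * (d + 1) * (d + 4) * (L : ℝ) ^ 2 * a ≤ 1 := small512_of_liftSmall hL ha hliftA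
    have hK : (0 : ℝ) < 512 * (d + 1) * (d + 4) * (L : ℝ) ^ 2 := by positivity
    rw [le_div_iff₀ hK]
    linarith
  exact residualPairing_torus L hL hLN hV hVP ha ha₀ hVa hψs hψP hcrit hDc

/-- The same with Bałaban's `avgIter` (B7 (42)–(43)) in the minimality hypothesis (`cavgIter_eq_avgIter`). [folklore] -/
theorem residualPairing_avgIter [Nonempty n] {L M' : ℕ} [NeZero L] [NeZero M'] (j : ℕ)
    {V : Site d → Fin d → (Matrix n n ℂ)ˣ} (hV : IsUnitaryCfg V) (hVP : IsPeriodicCfg V ((L : ℤ) * (L * tower L M' j : ℕ)))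
    {a b : ℝ} (ha : 0 ≤ a) (hab : a < b) (hb : LevelSmall d L (j + 1) b) (hVa : SmallField V a)
    (hmin : ∀ U : Site d → Fin d → (Matrix n n ℂ)ˣ, IsUnitaryCfg U → IsPeriodicCfg U ((L : ℤ) * (L * tower L M' j : ℕ)) →
      SmallField U b → avgIter L U (j + 2) = avgIter L V (j + 2) →
        fineAction V (blockWindow L (periodBox (L * tower L M' j))).2
          ≤ fineAction U (blockWindow L (periodBox (L * tower L M' j))).2)
    {ψ : Site d → Fin d → Matrix n n ℂ} (hψs : IsSkewDir ψ) (hψP : IsPeriodicDir ψ ((L : ℤ) * (L * tower L M' j : ℕ)))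
    (hψT : TangentIter L j (cavg L V) (cpush L V ψ)) {Dc : ℝ}
    (hDc : HasDerivAt
      (fun s : ℝ => coarseActionOf L (vary (bavg L V) (pushDir L V ψ) s) (blockWindow L (periodBox (L * tower L M' j))).1) Dc 0) :
    (L : ℝ) ^ ((d : ℤ) - 4) * |Dc|
      ≤ wallConst d L * (Real.sqrt (gradFluxSq V (blockSites L (periodBox (L * tower L M' j))))
          * Real.sqrt (curlSq V ψ (blockSites L (periodBox (L * tower L M' j))))
        + a ^ 2 * (dirL1 ψ (blockSites L (periodBox (L * tower L M' j)))
          + curlL1 V ψ (blockSites L (periodBox (L * tower L M' j))))) :=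
  residualPairing_multiLevel j hV hVP ha hab hb hVa (fun U hU hUP hUb hUeq =>
    hmin U hU hUP hUb (by rw [← cavgIter_eq_avgIter, ← cavgIter_eq_avgIter]; exact hUeq)) hψs hψP hψT hDc

end

end Summit.QuantumFields.BalabanUV.T4Continuum.NE3CurlPairedResidualMulti
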